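import Literature.AnabelianGeometry.AbsoluteAnabelian.AbsTopIII.FrobeniusPictureMLFCor36vJointModel
import Literature.AnabelianGeometry.AbsoluteAnabelian.AbsTopIII.FrobeniusPictureMLFTelecoreJointModel

/-!
# Kernel DAG index — layer X = MIXED delta (L4 ×1; one file per cycle under the live-queue discipline), part k (GENERATED by abc-iut-c312-2 gen 6 `work/gen_index.py` @2026-08-26T23:13Z from HOME/plan/DAG.tsv +
KERNEL-DAG-MODULES.tsv (regenerated 2026-08-26T22:23:37Z): 1 landed/discharged nodes NOT YET in the tree index Summits/ABC/IUTFork/DAG*.lean; spec v1.3 §2 (M))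

THIS FILE PROVES NOTHING NEW AND ASSERTS NOTHING (HOME/plan/KERNEL-DAG-SPEC.md). It gives ONE NAME `N_<kernel_id>` to each DAG node whose
statement has LANDED through the gate, knitting the landed declarations BY NAME: claim nodes `N_<id> : Prop := StatementOf @thm₁ ∧ …` (one
conjunct per landed theorem the DAG row names, universe levels instantiated explicitly per the spec's UNIVERSE RULE, arities read off the farm),
witnessed `N_<id>_holds` iff the DAG row is `discharged(p…)` and `N_<id>_part` otherwise (spec §2(b),(c); c312-2 F1/F2); data nodes
`abbrev N_<id> := @<primary>` with the row's further declarations as `example := @…` lines; FACT-style `def … : Prop` declarations are data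
here (a NAME, never asserted). Decl lists come from the `decls` column of plan/DAG.tsv as resolved against the tree sources (unresolvable
tokens dropped and reported to abc-iut-dag on STATUS). Nothing here says abc is proved or refuted or takes a side on [IUTchIII] Cor 3.12.
typed ≠ discharged; indexed ≠ endorsed.
-/

namespace Summit.ABC.IUTFork.DAG

namespace PartXk
/-- `StatementOf h` is the statement (a `Prop`) of which the landed `h` is the proof: the index NAMES statements, it never re-types them. -/
abbrev StatementOf {P : Prop} (_h : P) : Prop := P
end PartXk
open PartXk

noncomputable section
universe u₁ u₂ u₃ u₄ u₅ u₆ u₇ u₈ u₉ u₁₀ u₁₁ u₁₂ u₁₃ u₁₄ u₁₅ u₁₆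


/-- [node AbsTopIII:Cor3.6(v) · L4/D1 · [AbsTopIII] Cor 3.6 (v), kurims p.78 · p468731 · claim · DAG status discharged(p468731)] decls 2 · CORRECTED SIBLING of the mis-resolved landed alias `N_AbsTopIII_Cor3_6_v` (append-only re-key; dag: kernel_id := `N_AbsTopIII_Cor3_6_v'`) · decl list as NAMED BY THE AUDITOR/LEAD (forced, not re-resolved) · cites→ AbsTopIII:Cor1.10,AbsTopIII:Def3.1,AbsTopIII:Def3.5,AbsTopIII:Prop3.2,AbsTopIII:Rmk3.7.3 -/
def N_AbsTopIII_Cor3_6_v' : Prop :=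
  StatementOf @Literature.AnabelianGeometry.AbsoluteAnabelian.AbsTopIII.TFModel.cor_3_6_v_all_model ∧
  StatementOf @Literature.AnabelianGeometry.AbsoluteAnabelian.AbsTopIII.TFModel.cor_3_6_joint_model
/-- discharge of `N_AbsTopIII_Cor3_6_v'`: the landed theorems it names, BY NAME (spec §2(c)); proves nothing new. -/
theorem N_AbsTopIII_Cor3_6_v'_holds : N_AbsTopIII_Cor3_6_v' := ⟨@Literature.AnabelianGeometry.AbsoluteAnabelian.AbsTopIII.TFModel.cor_3_6_v_all_model, @Literature.AnabelianGeometry.AbsoluteAnabelian.AbsTopIII.TFModel.cor_3_6_joint_model⟩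

end

end Summit.ABC.IUTFork.DAG
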